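import Summits.HodgeConjecture.HodgeCM.PerL34.FockPrintDictionary_1

/-! PORT of `HodgeCM/PerL34/FockPrintDictionary.lean` (HodgeCMPerL run 82) — part 2: continuation of `Summits.HodgeConjecture.HodgeCM.PerL34.FockPrintDictionary_1` (split at a top-level declaration boundary by port_pkg.py; scope re-opened below; declarations unchanged). -/

-- port_pkg: scope re-opened for this part (file-level context, then the namespace/section stack open at the cut)
set_option autoImplicit false
namespace HodgeCM
namespace PerL34
namespace Fock
open MvPolynomial Complex
open scoped BigOperators
namespace PrintDict
section Darboux
variable {σ : Type*}
variable {W : Type*} [AddCommGroup W] [Module ℂ W]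
section Op
variable [Fintype σ]
variable [DecidableEq σ]
variable {B : W →ₗ[ℂ] W →ₗ[ℂ] ℂ} {e f : σ → W}
/-- **[Ad07] (2.5)(b) + Def. 2.7 + chunk p0010 `𝔨`-line**: `Z_{i,j} = f_j e_i + ½ ψ(δ_{i,j})` acts by
`λ (z_j d/dz_i + ½ δ_{ij})` (`f_j ↦ z_j`, `e_i ↦ ψ(1) d/dz_i = λ d/dz_i`, `ψ(δ_{ij}) = λ δ_{ij}`) (KERNEL). -/
theorem fockOp_Tzero (h : IsDarboux B e f) (lam : ℂ) (i j : σ) :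
    fockOp B e f lam (Tzero B lam e f i j) =
      lam • (mz j * dz i + (1 / 2 : ℂ) • (if i = j then 1 else 0)) := by
  have hA : ∀ a b, B (Tzero B lam e f i j (e b)) (f a) = if b = j then (if a = i then -lam else 0) else 0 := by
    intro a b
    rw [Tzero_apply_e h, map_smul, LinearMap.smul_apply, h.ef, smul_eq_mul]
    by_cases hb : b = j
    · subst hb
      by_cases ha : a = i
      · subst ha; simp
      · simp [ha, Ne.symm ha]
    · simp [hb, Ne.symm hb]
  have hB : ∀ a b, B (Tzero B lam e f i j (f b)) (f a) = 0 := by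
    intro a b
    rw [Tzero_apply_f h, map_smul, LinearMap.smul_apply, h.ff, smul_zero]
  have hC : ∀ a b, B (e a) (Tzero B lam e f i j (e b)) = 0 := by
    intro a b
    rw [Tzero_apply_e h, map_smul, h.ee, smul_zero]
  rw [fockOp_apply]
  simp only [hA, hB, hC, zero_smul, Finset.sum_const_zero, smul_zero, sub_zero, add_zero, sum_ite_smul_eq]
  simp only [ite_smul, zero_smul]
  by_cases hij : i = j
  · subst hij
    simp only [if_true]
    module
  · simp only [if_neg hij, if_neg (Ne.symm hij), smul_zero, add_zero, sub_zero, neg_smul, neg_neg]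

/-- **[Ad07] Def. 2.7 / chunk p0010, `𝔭⁺`-line**: `X⁺_{i,j} = f_i f_j` acts by `z_i z_j` (KERNEL; here `λ ≠ 0` is used:
the coefficient of `X⁺_{i,j}` in `M` is read off as `−(2λ)⁻¹ ⟨e_i, M e_j⟩`). -/
theorem fockOp_Tplus (h : IsDarboux B e f) {lam : ℂ} (hlam : lam ≠ 0) (i j : σ) :
    fockOp B e f lam (Tplus B lam f i j) = mz i * mz j := by
  have hA : ∀ a b, B (Tplus B lam f i j (e b)) (f a) = 0 := by
    intro a b
    rw [Tplus_apply_e h, map_add, map_smul, map_smul, LinearMap.add_apply, LinearMap.smul_apply,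
      LinearMap.smul_apply, h.ff, h.ff, smul_zero, smul_zero, add_zero]
  have hB : ∀ a b, B (Tplus B lam f i j (f b)) (f a) = 0 := by
    intro a b
    rw [Tplus_apply_f h, map_zero, LinearMap.zero_apply]
  have hC : ∀ a b, B (e a) (Tplus B lam f i j (e b)) =
      ((-lam) * (if i = b then 1 else 0)) * (if a = j then 1 else 0)
        + ((-lam) * (if j = b then 1 else 0)) * (if a = i then 1 else 0) := by
    intro a b
    rw [Tplus_apply_e h, map_add, map_smul, map_smul, h.ef, h.ef, smul_eq_mul, smul_eq_mul]
    ring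
  rw [fockOp_apply]
  simp only [hA, hB, hC, add_smul, Finset.sum_add_distrib, sum_sum_delta_smul, zero_smul,
    Finset.sum_const_zero, smul_zero, sub_zero, add_zero, neg_zero, zero_sub]
  rw [mz_comm j i, ← two_smul ℂ ((-lam) • (mz i * mz j)), smul_smul, smul_smul]
  have hc : (2 * lam)⁻¹ * 2 * -lam = -1 := by
    field_simp
  rw [hc, neg_one_smul, neg_neg]

/-- **[Ad07] Def. 2.7 / chunk p0010, `𝔭⁻`-line**: `X⁻_{i,j} = e_i e_j` acts by `ψ(1)² d²/dz_i dz_j = λ² ∂_i ∂_j` (KERNEL). -/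
theorem fockOp_Tminus (h : IsDarboux B e f) (lam : ℂ) (i j : σ) :
    fockOp B e f lam (Tminus B lam e i j) = lam ^ 2 • (dz i * dz j) := by
  have hA : ∀ a b, B (Tminus B lam e i j (e b)) (f a) = 0 := by
    intro a b
    rw [Tminus_apply_e h, map_zero, LinearMap.zero_apply]
  have hC : ∀ a b, B (e a) (Tminus B lam e i j (e b)) = 0 := by
    intro a b
    rw [Tminus_apply_e h, map_zero]
  have hB : ∀ a b, B (Tminus B lam e i j (f b)) (f a) =
      ((lam * (if i = b then 1 else 0)) * (if a = j then 1 else 0))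
        + ((lam * (if j = b then 1 else 0)) * (if a = i then 1 else 0)) := by
    intro a b
    rw [Tminus_apply_f h, map_add, map_smul, map_smul, LinearMap.add_apply, LinearMap.smul_apply,
      LinearMap.smul_apply, h.ef, h.ef, smul_eq_mul, smul_eq_mul]
    simp only [@eq_comm _ j a, @eq_comm _ i a]
  rw [fockOp_apply]
  simp only [hA, hB, hC, add_smul, Finset.sum_add_distrib, sum_sum_delta_smul, zero_smul,
    Finset.sum_const_zero, smul_zero, sub_zero, neg_zero, zero_add]
  rw [dz_comm j i, ← two_smul ℂ (lam • (dz i * dz j)), smul_smul, smul_smul]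
  congr 1
  ring

/-! ### 2.4 The action of `span (2.5)(a) ⊂ Ω²(W)` factors through `𝔰𝔭(W)`; Lemma 2.4's injectivity in coordinates

[Ad07] DEFINES the action of `𝔤 ≃ 𝔰𝔭(W)` on `ℂ[Y]` through the embedding of Lemma 2.4(b), i.e. through the
INVERSE of the isomorphism `span (2.5)(a) → 𝔰𝔭(W)` [p0007 L38 "this map is injective, and by dimension counting
it is an isomorphism"; p0009 L8].  The two theorems below make the bookkeeping kernel: `fockOp_spOf` — `fockOp`
evaluated on the image of ANY element of the span is Adams's term-by-term action of that element — so any two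
lifts of the same `M ∈ 𝔰𝔭(W)` act identically (`omegaOf_eq_of_spOf_eq`: single-valuedness without injectivity),
and `spOf_injective` — the printed injectivity itself, as coefficient extraction against the Darboux basis
(the `X^±` coordinates are determined up to the symmetry `X^±_{i,j} = X^±_{j,i}`). -/

/-- The element `Σ a_{ij} Z_{i,j} + Σ b_{ij} X⁺_{i,j} + Σ c_{ij} X⁻_{i,j}` of `𝔰𝔭(W)`: the image under Lemma 2.4's
map of the general element of the span of (2.5)(a) with coordinates `(a, b, c)`. -/
def spOf (B : W →ₗ[ℂ] W →ₗ[ℂ] ℂ) (lam : ℂ) (e f : σ → W) (a b c : σ → σ → ℂ) : W →ₗ[ℂ] W :=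
  ∑ i, ∑ j, a i j • Tzero B lam e f i j + ∑ i, ∑ j, b i j • Tplus B lam f i j
    + ∑ i, ∑ j, c i j • Tminus B lam e i j

/-- **Adams's definition, term by term** (Def. 2.7 + (2.5)(b) + chunk p0010): the same element of `Ω²(W)` acts on
`ℂ[Y]` by `Σ a_{ij} λ(z_j∂_i + ½δ_{ij}) + Σ b_{ij} z_iz_j + Σ c_{ij} λ²∂_i∂_j`. -/
noncomputable def omegaOf (lam : ℂ) (a b c : σ → σ → ℂ) : Module.End ℂ (MvPolynomial σ ℂ) :=
  ∑ i, ∑ j, a i j • (lam • (mz j * dz i + (1 / 2 : ℂ) • (if i = j then (1 : Module.End ℂ (MvPolynomial σ ℂ)) else 0)))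
    + ∑ i, ∑ j, b i j • (mz i * mz j) + ∑ i, ∑ j, c i j • (lam ^ 2 • (dz i * dz j))

/-- **`fockOp` computes Adams's action of every element of span (2.5)(a) (KERNEL, `λ ≠ 0`).** -/
theorem fockOp_spOf (h : IsDarboux B e f) {lam : ℂ} (hlam : lam ≠ 0) (a b c : σ → σ → ℂ) :
    fockOp B e f lam (spOf B lam e f a b c) = omegaOf lam a b c := by
  simp only [spOf, omegaOf, map_add, map_sum, map_smul, fockOp_Tzero h, fockOp_Tplus h hlam, fockOp_Tminus h]

/-- **LIFT INDEPENDENCE (KERNEL)**: two elements of span (2.5)(a) with the same image in `𝔰𝔭(W)` act identically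
on `ℂ[Y]`; so "the Fock operator of `M`" := Adams's action of any lift of `M` is single-valued and equals
`fockOp M` — for the VALUES no appeal to Lemma 2.4's injectivity is needed. -/
theorem omegaOf_eq_of_spOf_eq (h : IsDarboux B e f) {lam : ℂ} (hlam : lam ≠ 0) {a b c a' b' c' : σ → σ → ℂ}
    (heq : spOf B lam e f a b c = spOf B lam e f a' b' c') : omegaOf lam a b c = omegaOf lam a' b' c' := by
  rw [← fockOp_spOf h hlam, ← fockOp_spOf h hlam, heq]

/-- Coefficient extraction, `Z`-part: `⟨M e_k, f_m⟩ = −λ a_{mk}`. -/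
theorem B_spOf_e_f (h : IsDarboux B e f) (lam : ℂ) (a b c : σ → σ → ℂ) (k m : σ) :
    B (spOf B lam e f a b c (e k)) (f m) = -(lam * a m k) := by
  simp only [spOf, LinearMap.add_apply, LinearMap.coe_sum, Finset.sum_apply, LinearMap.smul_apply,
    Tzero_apply_e h, Tplus_apply_e h, Tminus_apply_e h, map_add, map_sum, map_smul, smul_zero, smul_add, h.ef,
    h.ff, Finset.sum_const_zero, add_zero, smul_eq_mul, mul_ite, mul_one, mul_zero, mul_neg, Finset.sum_ite_irrel,
    Finset.sum_ite_eq', Finset.mem_univ, if_true, Finset.sum_neg_distrib]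
  ring

/-- Coefficient extraction, `X⁺`-part: `⟨M e_k, e_m⟩ = λ (b_{km} + b_{mk})`. -/
theorem B_spOf_e_e (h : IsDarboux B e f) (lam : ℂ) (a b c : σ → σ → ℂ) (k m : σ) :
    B (spOf B lam e f a b c (e k)) (e m) = lam * (b k m + b m k) := by
  simp only [spOf, LinearMap.add_apply, LinearMap.coe_sum, Finset.sum_apply, LinearMap.smul_apply,
    Tzero_apply_e h, Tplus_apply_e h, Tminus_apply_e h, map_add, map_sum, map_smul, smul_zero, smul_add, h.ee,
    h.fe, Finset.sum_const_zero, add_zero, zero_add, smul_eq_mul, mul_ite, mul_one, mul_zero, mul_neg, neg_neg,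
    Finset.sum_ite_irrel, Finset.sum_ite_eq', Finset.mem_univ, if_true, Finset.sum_add_distrib,
    Finset.sum_neg_distrib]
  ring

/-- Coefficient extraction, `X⁻`-part: `⟨M f_k, f_m⟩ = λ (c_{km} + c_{mk})`. -/
theorem B_spOf_f_f (h : IsDarboux B e f) (lam : ℂ) (a b c : σ → σ → ℂ) (k m : σ) :
    B (spOf B lam e f a b c (f k)) (f m) = lam * (c k m + c m k) := by
  simp only [spOf, LinearMap.add_apply, LinearMap.coe_sum, Finset.sum_apply, LinearMap.smul_apply,
    Tzero_apply_f h, Tplus_apply_f h, Tminus_apply_f h, map_add, map_sum, map_smul, smul_zero, smul_add, h.ef,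
    h.ff, Finset.sum_const_zero, add_zero, zero_add, smul_eq_mul, mul_ite, mul_one, mul_zero, Finset.sum_ite_irrel,
    Finset.sum_ite_eq', Finset.mem_univ, if_true, Finset.sum_add_distrib]
  ring

/-- **[Ad07] Lemma 2.4, "this map is injective" [p0007 L38], on span (2.5)(a), in coordinates (KERNEL, `λ ≠ 0`)**:
equal images in `𝔰𝔭(W)` force equal `Z`-coordinates and equal symmetrised `X^±`-coordinates
(`X^±_{i,j} = X^±_{j,i}`, so only `b + bᵀ`, `c + cᵀ` are coordinates of the span). -/
theorem spOf_injective (h : IsDarboux B e f) {lam : ℂ} (hlam : lam ≠ 0) {a b c a' b' c' : σ → σ → ℂ}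
    (heq : spOf B lam e f a b c = spOf B lam e f a' b' c') :
    a = a' ∧ (∀ i j, b i j + b j i = b' i j + b' j i) ∧ (∀ i j, c i j + c j i = c' i j + c' j i) := by
  refine ⟨funext fun m => funext fun k => ?_, fun k m => ?_, fun k m => ?_⟩
  · have h1 := B_spOf_e_f h lam a b c k m
    rw [heq, B_spOf_e_f h lam a' b' c' k m, neg_inj] at h1
    exact (mul_left_cancel₀ hlam h1).symm
  · have h1 := B_spOf_e_e h lam a b c k m
    rw [heq, B_spOf_e_e h lam a' b' c' k m] at h1
    exact (mul_left_cancel₀ hlam h1).symm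
  · have h1 := B_spOf_f_f h lam a b c k m
    rw [heq, B_spOf_f_f h lam a' b' c' k m] at h1
    exact (mul_left_cancel₀ hlam h1).symm

end Op

end Darboux

/-! ## 3. The unitary group `U(V, h_s)` inside `Sp(V_ℝ)` ([Ad07] §§4–5) -/

section Unitary

variable {σ : Type*}

/-- `W = V^{1,0} ⊕ V^{0,1} ≅ V_ℝ ⊗_ℝ ℂ`, the complexification of the complex vector space `V = ℂ^σ` regarded as a
real vector space, in the coordinates `x ⊗ z ↦ (z·x, z·x̄)`; the real points `W₀ = V_ℝ` are the pairs `(x, x̄)`. -/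
abbrev Wc (σ : Type*) := (σ → ℂ) × (σ → ℂ)

/-- coordinate functionals -/
def π₁ (k : σ) : Wc σ →ₗ[ℂ] ℂ := (LinearMap.proj k).comp (LinearMap.fst ℂ (σ → ℂ) (σ → ℂ))

/-- coordinate functionals -/
def π₂ (k : σ) : Wc σ →ₗ[ℂ] ℂ := (LinearMap.proj k).comp (LinearMap.snd ℂ (σ → ℂ) (σ → ℂ))

/-- (Ported verbatim from the HodgeCMPerL package; no docstring in the source.) -/
@[simp] theorem π₁_apply (k : σ) (x : Wc σ) : π₁ k x = x.1 k := rfl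
/-- (Ported verbatim from the HodgeCMPerL package; no docstring in the source.) -/
@[simp] theorem π₂_apply (k : σ) (x : Wc σ) : π₂ k x = x.2 k := rfl

section Coord

variable [DecidableEq σ]

/-- the coordinate vector of `V^{1,0}` at `i` -/
def V10 (i : σ) : Wc σ := (Pi.single i 1, 0)

/-- the coordinate vector of `V^{0,1}` at `i` -/
def V01 (i : σ) : Wc σ := (0, Pi.single i 1)

/-- (Ported verbatim from the HodgeCMPerL package; no docstring in the source.) -/
@[simp] theorem V10_fst (i : σ) : (V10 i).1 = Pi.single i 1 := rfl
/-- (Ported verbatim from the HodgeCMPerL package; no docstring in the source.) -/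
@[simp] theorem V10_snd (i : σ) : (V10 i).2 = 0 := rfl
/-- (Ported verbatim from the HodgeCMPerL package; no docstring in the source.) -/
@[simp] theorem V01_fst (i : σ) : (V01 i).1 = 0 := rfl
/-- (Ported verbatim from the HodgeCMPerL package; no docstring in the source.) -/
@[simp] theorem V01_snd (i : σ) : (V01 i).2 = Pi.single i 1 := rfl

/-- The Darboux vectors `f_i ∈ Y` (`z_i` is the coordinate dual to `f_i`): `f_i` is the `V^{1,0}`-coordinate
vector for a positive sign and the `V^{0,1}`-coordinate vector for a negative sign. -/
def ff (s : σ → ℤ) (i : σ) : Wc σ := if s i = 1 then V10 i else V01 i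

/-- The Darboux vectors `e_i ∈ X` dual to the `f_i` (`⟨e_i, f_j⟩ = δ_{ij}`). -/
noncomputable def ee (s : σ → ℤ) (i : σ) : Wc σ := (-I) • (if s i = 1 then V01 i else V10 i)

/-- (Ported verbatim from the HodgeCMPerL package; no docstring in the source.) -/
theorem single_apply' (i j : σ) (c : ℂ) (i' j' : σ) :
    Matrix.single i j c i' j' = if i = i' ∧ j = j' then c else 0 := rfl

end Coord

section Form

variable [Fintype σ]

/-- **The symplectic form.** For the hermitian form `h_s(x, y) = Σ_k s_k x_k ȳ_k` of signs `s : σ → {±1}` on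
`V = ℂ^σ`, the real symplectic form `2 Im h_s` on `V_ℝ = W₀` extends complex-bilinearly to `W`; in the coordinates
above it is `⟨(u, u′), (v, v′)⟩ = (1/i) Σ_k s_k (u_k v′_k − u′_k v_k)` (`sf_real`: on real points it IS `2 Im h_s`). -/
noncomputable def sf (s : σ → ℤ) : Wc σ →ₗ[ℂ] Wc σ →ₗ[ℂ] ℂ :=
  I⁻¹ • ∑ k, (s k : ℂ) • ((LinearMap.mul ℂ ℂ).compl₁₂ (π₁ k) (π₂ k) - (LinearMap.mul ℂ ℂ).compl₁₂ (π₂ k) (π₁ k))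

/-- (Ported verbatim from the HodgeCMPerL package; no docstring in the source.) -/
@[simp] theorem sf_apply (s : σ → ℤ) (x y : Wc σ) :
    sf s x y = I⁻¹ * ∑ k, (s k : ℂ) * (x.1 k * y.2 k - x.2 k * y.1 k) := by
  simp only [sf, LinearMap.smul_apply, LinearMap.coe_sum, Finset.sum_apply, LinearMap.sub_apply,
    LinearMap.compl₁₂_apply, LinearMap.mul_apply', π₁_apply, π₂_apply, smul_eq_mul, Finset.mul_sum]

/-- `⟨ , ⟩` is alternating (KERNEL). -/
theorem sf_alt (s : σ → ℤ) (x y : Wc σ) : sf s x y = -sf s y x := by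
  rw [sf_apply, sf_apply, ← mul_neg, ← Finset.sum_neg_distrib]
  congr 1
  refine Finset.sum_congr rfl fun k _ => ?_
  ring

/-- On real points `(x, x̄)`, `(y, ȳ)` the form is `2 Im h_s(x, y)`, `h_s(x,y) = Σ s_k x_k ȳ_k` (KERNEL): this is
the symplectic space `(V_ℝ, 2 Im h_s)` in which `U(V, h_s)` sits ([Ad07] §5: "`(G, G′)` a reductive dual pair
in `Sp(2n, ℝ)`"; PerL v5 tex ll. 262–264: the Weil representation "on 𝒮((V_3⊗W)(𝔸))", "at the archimedean
place we use the Fock (polynomial) model"). -/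
theorem sf_real (s : σ → ℤ) (x y : σ → ℂ) :
    sf s (x, star x) (y, star y) = 2 * ((∑ k, (s k : ℂ) * (x k * star (y k))).im : ℂ) := by
  have him : ∀ z : ℂ, (2 : ℂ) * (z.im : ℂ) = I⁻¹ * (z - star z) := by
    intro z
    rw [Complex.inv_I, RCLike.star_def, Complex.sub_conj]
    push_cast
    ring_nf
    rw [Complex.I_sq]
    ring
  rw [him, star_sum, ← Finset.sum_sub_distrib, sf_apply]
  congr 1
  refine Finset.sum_congr rfl fun k _ => ?_
  simp only [star_mul', RCLike.star_def, map_intCast, Complex.conj_conj, Pi.star_apply]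
  ring

/-- **The embedding `ρ : 𝔤𝔩(V) → 𝔤𝔩(W)`**: the complexification of the real-linear action of `𝔲(V, h_s)` on
`V_ℝ = W₀`.  In the coordinates `(u, u′)` of `W = V^{1,0} ⊕ V^{0,1}`:
`ρ(A)(u, u′) = (A u, −H Aᵀ H u′)`, `H = diag(s)` — for `A ∈ 𝔲(h_s)` one has `−H Aᵀ H = Ā`, so `ρ(A)(x, x̄) =
(A x, conj (A x))` (`rho_real`): `ρ(A)` is the given real action. -/
noncomputable def rho (s : σ → ℤ) (A : Matrix σ σ ℂ) : Wc σ →ₗ[ℂ] Wc σ where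
  toFun x := (fun k => ∑ l, A k l * x.1 l, fun k => -∑ l, ((s k * s l : ℤ) : ℂ) * A l k * x.2 l)
  map_add' x y := by
    ext k
    · simp only [Prod.fst_add, Pi.add_apply, mul_add, Finset.sum_add_distrib]
    · simp only [Prod.snd_add, Pi.add_apply, mul_add, Finset.sum_add_distrib, neg_add]
  map_smul' c x := by
    ext k
    · simp only [Prod.smul_fst, Pi.smul_apply, smul_eq_mul, RingHom.id_apply, Finset.mul_sum]
      exact Finset.sum_congr rfl fun l _ => by ring
    · simp only [Prod.smul_snd, Pi.smul_apply, smul_eq_mul, RingHom.id_apply, mul_neg, Finset.mul_sum, neg_inj]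
      exact Finset.sum_congr rfl fun l _ => by ring

/-- (Ported verbatim from the HodgeCMPerL package; no docstring in the source.) -/
@[simp] theorem rho_apply_fst (s : σ → ℤ) (A : Matrix σ σ ℂ) (x : Wc σ) (k : σ) :
    (rho s A x).1 k = ∑ l, A k l * x.1 l := rfl

/-- (Ported verbatim from the HodgeCMPerL package; no docstring in the source.) -/
@[simp] theorem rho_apply_snd (s : σ → ℤ) (A : Matrix σ σ ℂ) (x : Wc σ) (k : σ) :
    (rho s A x).2 k = -∑ l, ((s k * s l : ℤ) : ℂ) * A l k * x.2 l := rfl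

/-- (Ported verbatim from the HodgeCMPerL package; no docstring in the source.) -/
theorem rho_add (s : σ → ℤ) (A A' : Matrix σ σ ℂ) : rho s (A + A') = rho s A + rho s A' := by
  apply LinearMap.ext
  intro x
  ext k
  · simp only [rho_apply_fst, Matrix.add_apply, LinearMap.add_apply, Prod.fst_add, Pi.add_apply, add_mul,
      Finset.sum_add_distrib]
  · simp only [rho_apply_snd, Matrix.add_apply, LinearMap.add_apply, Prod.snd_add, Pi.add_apply, mul_add,
      add_mul, Finset.sum_add_distrib, neg_add]

/-- (Ported verbatim from the HodgeCMPerL package; no docstring in the source.) -/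
theorem rho_smul (s : σ → ℤ) (c : ℂ) (A : Matrix σ σ ℂ) : rho s (c • A) = c • rho s A := by
  apply LinearMap.ext
  intro x
  ext k
  · simp only [rho_apply_fst, Matrix.smul_apply, smul_eq_mul, LinearMap.smul_apply, Prod.smul_fst,
      Pi.smul_apply, Finset.mul_sum]
    exact Finset.sum_congr rfl fun l _ => by ring
  · simp only [rho_apply_snd, Matrix.smul_apply, smul_eq_mul, LinearMap.smul_apply, Prod.smul_snd,
      Pi.smul_apply, mul_neg, Finset.mul_sum, neg_inj]
    exact Finset.sum_congr rfl fun l _ => by ring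

/-- `ρ` as a `ℂ`-linear map in `A` (for linear extension from the matrix units). -/
noncomputable def rhoLin (s : σ → ℤ) : Matrix σ σ ℂ →ₗ[ℂ] (Wc σ →ₗ[ℂ] Wc σ) where
  toFun := rho s
  map_add' := rho_add s
  map_smul' := rho_smul s

/-- (Ported verbatim from the HodgeCMPerL package; no docstring in the source.) -/
@[simp] theorem rhoLin_apply (s : σ → ℤ) (A : Matrix σ σ ℂ) : rhoLin s A = rho s A := rfl

/-- The Lie algebra `𝔲(V, h_s) = {A : A^* H + H A = 0}`, `H = diag(s)`, entrywise. -/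
def IsSkewHerm (s : σ → ℤ) (A : Matrix σ σ ℂ) : Prop := ∀ k l, star (A l k) * (s l : ℂ) = -((s k : ℂ) * A k l)

/-- **`ρ` is the complexification of the real action** (KERNEL): for `A ∈ 𝔲(V, h_s)` (and signs `s_k = ±1`),
`ρ(A)` maps the real point `(x, x̄)` to the real point `(A x, conj (A x))`. -/
theorem rho_real {s : σ → ℤ} (hs : ∀ k, s k * s k = 1) {A : Matrix σ σ ℂ} (hA : IsSkewHerm s A) (x : σ → ℂ) :
    rho s A (x, star x) = (fun k => ∑ l, A k l * x l, star (fun k => ∑ l, A k l * x l)) := by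
  ext k
  · simp only [rho_apply_fst]
  · simp only [rho_apply_snd, Pi.star_apply, star_sum, star_mul', ← Finset.sum_neg_distrib]
    refine Finset.sum_congr rfl fun l _ => ?_
    have h1 := hA l k
    have h4 : (s k : ℂ) * s k = 1 := by exact_mod_cast hs k
    have h3 : star (A k l) = -((s k * s l : ℤ) : ℂ) * A l k := by
      have h5 := congrArg (fun z => z * (s k : ℂ)) h1
      simp only [mul_assoc, h4, mul_one] at h5
      rw [h5]
      push_cast
      ring
    rw [h3]
    ring

variable [DecidableEq σ]

/-- `ρ(c E_{k,l})` in coordinates: `(u, u′) ↦ (c u_l · δ_k, −s_k s_l c u′_k · δ_l)` (KERNEL). -/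
theorem rho_single_apply (s : σ → ℤ) (k l : σ) (c : ℂ) (x : Wc σ) :
    rho s (Matrix.single k l c) x =
      (Pi.single k (c * x.1 l), Pi.single l (-(((s l * s k : ℤ) : ℂ) * c * x.2 k))) := by
  ext m
  · simp only [rho_apply_fst, single_apply', ite_and, ite_mul, zero_mul, Finset.sum_ite_irrel,
      Finset.sum_ite_eq, Finset.mem_univ, if_true, Finset.sum_const_zero, Pi.single_apply]
    by_cases h : k = m
    · subst h; simp
    · simp [h, Ne.symm h]
  · simp only [rho_apply_snd, single_apply', ite_and, ite_mul, mul_ite, zero_mul, mul_zero,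
      Finset.sum_ite_eq, Finset.mem_univ, if_true, Pi.single_apply]
    by_cases h : l = m
    · subst h; simp
    · simp [h, Ne.symm h]

/-- **The complex structure `J` of [Ad07] §4** (`X` = the `i`-eigenspace of `J`, `{v, w} = ⟨v, J w⟩ − i⟨v, w⟩`
positive definite): here `J = ρ(diag(−i s_k))`, an element of (the image of) the compact torus
`𝔲(1)^σ ⊂ 𝔲(V, h_s)`. -/
noncomputable def J0 (s : σ → ℤ) : Wc σ →ₗ[ℂ] Wc σ := rho s (Matrix.diagonal fun k => -I * (s k : ℂ))

end Form

end Unitary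

/-! ## 4. The indefinite pair `(U(2,1), U(1)) ⊂ Sp(6, ℝ)`: the package's `ℂ[z₁, z₂, w]` and `osc` -/

section Indefinite

/-- sums over `HarmVar = Fin 2 ⊕ Unit` -/
theorem sum_harmVar {M : Type*} [AddCommMonoid M] (g : HarmVar → M) :
    ∑ k, g k = g (Sum.inl 0) + g (Sum.inl 1) + g (Sum.inr ()) := by
  rw [Fintype.sum_sum_type, Fin.sum_univ_two, Fintype.sum_unique]

/-- (Ported verbatim from the HodgeCMPerL package; no docstring in the source.) -/
theorem mz_inr_mul_mz_inl (a : Fin 2) :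
    mz (σ := HarmVar) (Sum.inr ()) * mz (Sum.inl a) = mz (Sum.inl a) * mz (Sum.inr ()) := mz_comm _ _


-- port_pkg: scope closed for this part
end Indefinite
end PrintDict
end Fock
end PerL34
end HodgeCM
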